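import Literature.Probability.LatticeModels.IsingCriticalBetaConnectiveConstant
import Literature.Probability.RandomPlanarGeometry.SAWFiniteMemoryZ3K10
import Literature.ComputerArithmetic.DeDinechinLauterMullerTorres2013.TinyArguments
import HarnessLib

/-!
# `β_c(ℤ³) > artanh(1/4.76) = 0.21326…` for the nearest-neighbour Ising model, from Fisher's bound and the kernel bound `μ(ℤ³) ≤ 4.76`

Topic `Literature/Probability/LatticeModels`. Theorem-only file (no definition, no named fact, no sorry); COMPUTATIONAL
(the bound `μ(ℤ³) ≤ 4.76` of `SAWFiniteMemoryZ3K10.lean` rests on one `native_decide` evaluation of the Pönitz–Tittmann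
memory-10 certificate).  Fisher's inequality in canonical form (`lt_criticalBeta_of_le_of_mul_tanh_lt_one`,
`IsingCriticalBetaConnectiveConstant.lean`: `μ(d) ≤ μ̄`, `μ̄·tanh β < 1 ⇒ β < β_c(d)`) with `μ̄ = 4.76`
(`SAW.Zd.connectiveConstant_three_le_476`) gives

* `lt_criticalBeta_three_of_tanh_lt_inv_476` — **`tanh β < 1/4.76 ⇒ β < β_c(3)`**, i.e. `β_c(ℤ³) ≥ artanh(1/4.76) = 0.213260…`
  (the tree's previous explicit value: `tanh β < 1000/4865`, memory 4, `lt_criticalBeta_three_of_tanh_lt`; the numerical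
  value is `β_c(ℤ³) ≈ 0.22165`).

References: M. E. Fisher, Phys. Rev. 162 (1967) 480 [Fisher1967]; A. Pönitz, P. Tittmann, Electron. J. Combin. 7 (2000) R21,
Table 2 [PonitzTittmann2000].
-/

noncomputable section

namespace Literature.Probability.LatticeModels

open Literature.Probability.RandomPlanarGeometry.SAW.Zd (connectiveConstant connectiveConstant_three_le_476)

/-- **`tanh β < 1/4.76 ⇒ β < β_c(ℤ³)`** (`β ≥ 0`): Fisher's `tanh β_c ≥ 1/μ` with the kernel-checked `μ(ℤ³) ≤ 4.76`; so
`β_c(ℤ³) ≥ artanh(1/4.76) = 0.213260…`. [cite: Fisher1967, Phys. Rev. 162 (1967) 480 (tanh(J/kT_c) ≥ 1/μ); PonitzTittmann2000, Table 2 (d = 3, k = 10)] -/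
theorem lt_criticalBeta_three_of_tanh_lt_inv_476 {β : ℝ} (hβ : 0 ≤ β) (h : Real.tanh β < 1 / 4.76) :
    β < criticalBeta 3 := by
  refine lt_criticalBeta_of_le_of_mul_tanh_lt_one (d := 3) (by norm_num) hβ connectiveConstant_three_le_476 ?_
  have h' : 4.76 * Real.tanh β < 4.76 * (1 / 4.76) := mul_lt_mul_of_pos_left h (by norm_num)
  linarith

/-- The same as a membership statement: `artanh(1/4.76)`-cell — `β = 21/100 < β_c(ℤ³)` (`tanh 0.21 ≤ 0.20697 < 1/4.76 = 0.21008`).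
[cite: Fisher1967, Phys. Rev. 162 (1967) 480; PonitzTittmann2000, Table 2 (d = 3, k = 10)] -/
theorem criticalBeta_three_gt_21 : (21 / 100 : ℝ) < criticalBeta 3 := by
  refine lt_criticalBeta_three_of_tanh_lt_inv_476 (by norm_num) ?_
  have hp : Real.tanh (21 / 100 : ℝ) ≤ 21 / 100 - (21 / 100 : ℝ) ^ 3 / 3 + 2 / 15 * (21 / 100 : ℝ) ^ 5 :=
    (Literature.ComputerArithmetic.DeDinechinLauterMullerTorres2013.tanh_quintic_bounds (by norm_num) (by norm_num)).2
  exact hp.trans_lt (by norm_num)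

end Literature.Probability.LatticeModels

end
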